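import Literature.Probability.Percolation.ArmSeparationExtGuard
import Literature.Probability.Percolation.ArmSeparationExtSpoke
import Literature.Probability.Percolation.ArmSeparationExtLandingGlue
import Literature.Probability.Percolation.ArmSeparationSlotSep
import HarnessLib

/-!
# Slots of the outer landing step: parameters, routing and events

Topic: Probability / Percolation; family `crit-perc`. A brick of the discharge of
`Literature.Probability.Percolation.Nolin2008_twoArm_separation` (Nolin 2008, Thm. 11
[arXiv 0711.4948: Thm. 10], `j = 2`, `σ = BW`; `ArmSeparation.lean`), landing step of the EXTERNAL
extremities — the mirror image, outside `Λ_{2M}`, of `ArmSeparationSlotDefs.lean`. The guarded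
tiny-fenced two-arm event `OutTinyExtG M n k₀ K R₀` (`ArmSeparationExtGuard.lean`) is decomposed
according to the **slot** (`ESlot`: side `io, ic < 6`, scale index `jo, jc < K` and window index
`no, nc` of the tip rows, windows of width `w = k₀/4` on `[-2M, 0]`) of the two tips, and to each
slot are attached the corridor events of the two landing moves: the spoke from the corner box of
the fence (`extSpokeEvent`, `ArmSeparationExtSpoke.lean`), an arc of a thin ring OUTSIDE `Λ_{2M}`
(radius `r_B ∈ (2M + μ, 2M + μ + s]` for the open arm, `r_W ∈ (2M + 3μ, 2M + 3μ + s]` for the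
closed one, `μ = k₀ 32^K`), and the four landing crossings `extE2 … extE5` towards the landing zone
of `∂Λ_N` (`ArmSeparationExtLandingGlue.lean`), with the same **routing** as inside: the exit row of
each colour avoids the other tip when that tip sits on the exit's side (`ESlot.bo`, `ESlot.bc`),
and each arc is the complement of the window of ring tubes that the other colour may touch. Read
in the original frame, the entry piece of a spoke of the rotated frame `i` is the ring tube at the
position `blockOff n i + 2ι` for every `i` (the rotations list the pieces of the sides `2`, `5` in
the ring's own order).

## References

* P. Nolin, *Near-critical percolation in two dimensions*, Electron. J. Probab. 13 (2008), §4.2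
  Def. 6–8, §4.3 Prop. 12, §4.4 [arXiv 0711.4948: Def. 6–8, Prop. 11, Thm. 10]. [Nolin2008]
* H. Kesten, *Scaling relations for 2D-percolation*, Comm. Math. Phys. 109 (1987), Lemma 2, §2. [Kesten1987]
-/

noncomputable section

open Set

namespace Literature.Probability.Percolation

open LatticeModels Tube

/-! ### Parameters of a rung -/

/-- **The parameters of one rung of the outer landing step**: surgery radius `M` (tips on
`∂Λ_{2M}`), inner radius `n` of the arm event, target radius `N` (`4M ≤ N`), smallest fence scale
`k₀`, number of scales `K`, tip margin `R₀`. [cite: Nolin2008, §4.4 (arXiv 0711.4948: Thm. 10, external extremities)] -/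
structure EParams where
  /-- surgery radius: the tips sit on `∂Λ_{2M}` -/
  M : ℕ
  /-- inner radius of the arm event -/
  n : ℕ
  /-- target radius -/
  N : ℕ
  /-- smallest fence scale -/
  k₀ : ℕ
  /-- number of fence scales -/
  K : ℕ
  /-- margin of the tips from the corners -/
  R₀ : ℕ

namespace EParams

variable (P : EParams)

/-- window width `w = k₀ / 4` [folklore] -/
def w : ℕ := P.k₀ / 4
/-- spoke half-width `ε = k₀ / 16` [folklore] -/
def ε : ℕ := P.k₀ / 16
/-- ring tube half-width `e = k₀ / 4` [folklore] -/
def e : ℕ := P.k₀ / 4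
/-- ring chunk length `s = k₀` [folklore] -/
def s : ℕ := P.k₀
/-- depth unit `μ = k₀ 32^K` [folklore] -/
def μ : ℕ := trapScale P.k₀ P.K
/-- radius of the ring of the open arm, a multiple of `s` in `(2M + μ, 2M + μ + s]` [folklore] -/
def rB : ℕ := P.s * ((2 * P.M + P.μ) / P.s + 1)
/-- radius of the ring of the closed arm, a multiple of `s` in `(2M + 3μ, 2M + 3μ + s]` [folklore] -/
def rW : ℕ := P.s * ((2 * P.M + 3 * P.μ) / P.s + 1)
/-- reach of the spokes of the open arm: `2M + LB = rB + e + s` [folklore] -/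
def LB : ℕ := P.rB + P.e + P.s - 2 * P.M
/-- reach of the spokes of the closed arm [folklore] -/
def LW : ℕ := P.rW + P.e + P.s - 2 * P.M
/-- width of the approach tube of the open arm: `rB - e - 1 + WB = N - 1` [folklore] -/
def WB : ℕ := P.N + P.e - P.rB
/-- width of the approach tube of the closed arm [folklore] -/
def WW : ℕ := P.N + P.e - P.rW
/-- chunks per side of the ring of the open arm [folklore] -/
def nB : ℕ := P.rB / P.s
/-- chunks per side of the ring of the closed arm [folklore] -/
def nW : ℕ := P.rW / P.s
/-- number of windows of tip rows [folklore] -/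
def Nw : ℕ := 2 * P.M / P.w + 1
/-- start of the `ν`-th window [folklore] -/
def T₀ (ν : ℕ) : ℤ := -(2 * (P.M : ℤ)) + ν * P.w
/-- pieces in the exit run of the open arm: `dB s ≥ rB/64 + 2s` [folklore] -/
def dB : ℕ := P.rB / 64 / P.s + 3
/-- pieces in the exit run of the closed arm [folklore] -/
def dW : ℕ := P.rW / 64 / P.s + 3
/-- length of the arc of the open arm: its ring minus a window of eight tubes [folklore] -/
def lenB : ℕ := 12 * P.nB - 4 - 8

/-- **The danger zone** of the upper exit row `t = tgtRow r true` of a ring of radius `r`: the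
lateral positions `[t - r/64 - μ - 8s, t + r/64 + μ + 8s]` on the exit's side. [folklore] -/
def Danger (r : ℕ) (ξ : ℤ) : Prop :=
  tgtRow r true - (r / 64 : ℕ) - P.μ - 8 * P.s ≤ ξ ∧ ξ ≤ tgtRow r true + (r / 64 : ℕ) + P.μ + 8 * P.s

/-- The danger zone is decidable. [folklore] -/
instance (r : ℕ) (ξ : ℤ) : Decidable (P.Danger r ξ) := by unfold Danger; infer_instance

end EParams

/-! ### Slots and routing -/

/-- **A slot of the outer landing step**: side, scale index and window index of the open tip
(`io, jo, no`) and of the closed tip (`ic, jc, nc`). [cite: Nolin2008, §4.4 (arXiv 0711.4948: Thm. 10, external extremities)] -/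
structure ESlot where
  /-- side of the open tip -/
  io : ℕ
  /-- scale index of the open tip -/
  jo : ℕ
  /-- window index of the open tip -/
  no : ℕ
  /-- side of the closed tip -/
  ic : ℕ
  /-- scale index of the closed tip -/
  jc : ℕ
  /-- window index of the closed tip -/
  nc : ℕ
  deriving DecidableEq

namespace ESlot

variable (P : EParams) (σ : ESlot)

/-- scale of the open tip [folklore] -/
def ko : ℕ := trapScale P.k₀ σ.jo
/-- scale of the closed tip [folklore] -/
def kc : ℕ := trapScale P.k₀ σ.jc
/-- window start of the open tip [folklore] -/
def To : ℤ := P.T₀ σ.no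
/-- window start of the closed tip [folklore] -/
def Tc : ℤ := P.T₀ σ.nc
/-- **Alignment of a spoke row**: the offset (`0` or `2ε`) that keeps the rows `[ξ, ξ + 2ε]` of a
spoke inside one lateral chunk of the rings (radii multiples of `s`), needed by the diagonal
junctions of the frames `2`, `5`. [folklore] -/
def _root_.Literature.Probability.Percolation.EParams.adj (P : EParams) (ξ₀ : ℤ) : ℕ :=
  if (ξ₀ + P.rB).toNat % P.s + 2 * P.ε ≤ P.s then 0 else 2 * P.ε
/-- effective window parameter of the black spoke (window width plus alignment offset) [folklore] -/
def wo : ℕ := P.w + P.adj (σ.To P + P.w + σ.ko P + (σ.ko P / 4 : ℕ))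
/-- effective window parameter of the white spoke [folklore] -/
def wc : ℕ := P.w + P.adj (σ.Tc P + P.w + σ.kc P + (σ.kc P / 4 : ℕ))
/-- lower row of the spoke of the open tip (in its frame) [folklore] -/
def ξo : ℤ := σ.To P + σ.wo P + σ.ko P + (σ.ko P / 4 : ℕ)
/-- lower row of the spoke of the closed tip (in its frame) [folklore] -/
def ξc : ℤ := σ.Tc P + σ.wc P + σ.kc P + (σ.kc P / 4 : ℕ)
/-- frame of the closed tip after colour exchange [folklore] -/
def ic' : ℕ := (σ.ic + 3) % 6

/-- exit row bit of the open arm: the upper row unless the closed tip sits on side `0` in its danger zone [folklore] -/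
def bo : Bool := !decide (σ.ic = 0 ∧ P.Danger P.rB (σ.ξc P))
/-- exit row bit of the closed arm: the upper row unless the open tip sits on side `3` in its danger zone [folklore] -/
def bc : Bool := !decide (σ.io = 3 ∧ P.Danger P.rW (σ.ξo P))
/-- exit row of the open arm [folklore] -/
def tgo : ℤ := tgtRow P.rB (σ.bo P)
/-- exit row of the closed arm (in the colour-exchanged picture) [folklore] -/
def tgc : ℤ := tgtRow P.rW (σ.bc P)

/-- lateral index of the black spoke on ring `B` [folklore] -/
def ιo : ℕ := latIdx P.s P.rB (σ.ξo P)
/-- position of the entry piece of the open arm in ring `B` [folklore] -/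
def gEo : ℕ := blockOff P.nB σ.io + 2 * σ.ιo P
/-- lateral index of the white spoke on ring `W` (colour-exchanged picture) [folklore] -/
def ιw : ℕ := latIdx P.s P.rW (σ.ξc P)
/-- position of the entry piece of the closed arm in ring `W` [folklore] -/
def gEc : ℕ := blockOff P.nW σ.ic' + 2 * σ.ιw P

/-- lateral index of the white spoke on ring `B` [folklore] -/
def ιc : ℕ := latIdx P.s P.rB (σ.ξc P)
/-- the window of ring `B` touched by the white spoke: first position (the pieces of lateral index
`ιc - 2, …, ιc + 1` and their connectors: read in the original frame a diagonal spoke of the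
frames `2`, `5` may touch four consecutive chunks) [folklore] -/
def loB : ℕ := blockOff P.nB σ.ic + 2 * (σ.ιc P - 2)
/-- the window of ring `B`: last position (eight tubes) [folklore] -/
def hiB : ℕ := σ.loB P + 7
/-- start of the arc of the open arm [folklore] -/
def aB : ℕ := σ.hiB P + 1

/-- lateral indices of the window of ring `W` touched by the black approach tube (side `3`) [folklore] -/
def yLo : ℕ := latIdx P.s P.rW (σ.tgo P) - 1
/-- lateral indices of the window of ring `W`: last [folklore] -/
def yHi : ℕ := latIdx P.s P.rW (σ.tgo P + (P.rB / 64 : ℕ)) + 1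
/-- the window of ring `W`: first position [folklore] -/
def loW : ℕ := blockOff P.nW 3 + 2 * σ.yLo P
/-- the window of ring `W`: last position [folklore] -/
def hiW : ℕ := blockOff P.nW 3 + 2 * σ.yHi P + 1
/-- start of the arc of the closed arm [folklore] -/
def aW : ℕ := σ.hiW P + 1
/-- length of the arc of the closed arm [folklore] -/
def lenW : ℕ := 12 * P.nW - 4 - (σ.hiW P - σ.loW P + 1)

/-- first piece of the exit run of the open arm (side `0` of ring `B`) [folklore] -/
def xo : ℕ := latIdx P.s P.rB (σ.tgo P)
/-- first piece of the exit run of the closed arm (side `0` of ring `W`) [folklore] -/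
def xc : ℕ := latIdx P.s P.rW (σ.tgc P)

/-- height of the connector band of the open arm: `-N/2 - N/64 + HB = tgo + rB/64` [folklore] -/
def HB : ℕ := (σ.tgo P + (P.rB / 64 : ℕ) + (P.N / 2 : ℕ) + (P.N / 64 : ℕ)).toNat
/-- height of the connector band of the closed arm [folklore] -/
def HW : ℕ := (σ.tgc P + (P.rW / 64 : ℕ) + (P.N / 2 : ℕ) + (P.N / 64 : ℕ)).toNat

end ESlot

/-! ### The four events of a slot -/

/-- **The corridor of one colour** in the normalised picture: spoke, arc, approach tube, connector
band, fence line, thinned outer free space. [cite: Nolin2008, §4.3 Prop. 12 (proof) (arXiv 0711.4948: Prop. 11)] -/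
def extCorrEvent (i M N k : ℕ) (T₀ : ℤ) (w L ε r e s a len : ℕ) (t : ℤ) (W H : ℕ) : Set (SiteConfig (Site 2)) :=
  extSpokeEvent i M k T₀ w L ε ∩ eventAll (arc (thinRing r e s) a len) ∩ extE2 r e t W ∩ extE3 N H ∩ extE4 N ∩ extE5 N

namespace ESlot

variable (P : EParams) (σ : ESlot)

/-- **The corridor of the open arm of the slot.** [cite: Nolin2008, §4.3 Prop. 12 (proof) (arXiv 0711.4948: Prop. 11)] -/
def blackCorr : Set (SiteConfig (Site 2)) :=
  extCorrEvent σ.io P.M P.N (σ.ko P) (σ.To P) (σ.wo P) (P.LB - σ.ko P) P.ε P.rB P.e P.s (σ.aB P) P.lenB (σ.tgo P) P.WB (σ.HB P)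

/-- **The corridor of the closed arm of the slot** (through `negFlip`). [cite: Nolin2008, §4.3 Prop. 12 (proof) (arXiv 0711.4948: Prop. 11)] -/
def whiteCorr : Set (SiteConfig (Site 2)) :=
  negFlip ⁻¹' extCorrEvent σ.ic' P.M P.N (σ.kc P) (σ.Tc P) (σ.wc P) (P.LW - σ.kc P) P.ε P.rW P.e P.s (σ.aW P) (σ.lenW P) (σ.tgc P)
    P.WW (σ.HW P)

/-- **The fenced open arm with tip in the slot**: a fenced arm of the frame `io` at scale index
`jo`, its tip in the `no`-th window and away from the corners. [cite: Nolin2008, §4.4 (arXiv 0711.4948: Thm. 10, external extremities)] -/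
def blackArm : Set (SiteConfig (Site 2)) :=
  {ω | ∃ F : TrapFencedArm P.M P.n P.k₀ P.K (rotConfig σ.io ω),
    F.j = σ.jo ∧ σ.To P ≤ F.z 1 ∧ F.z 1 < σ.To P + P.w ∧ GoodTip P.M P.R₀ F.z}

/-- **The fenced closed arm with tip in the slot.** [cite: Nolin2008, §4.4 (arXiv 0711.4948: Thm. 10, external extremities)] -/
def whiteArm : Set (SiteConfig (Site 2)) :=
  {ω | ∃ F : TrapFencedArm P.M P.n P.k₀ P.K (rotConfig σ.ic ω)ᶜ,
    F.j = σ.jc ∧ σ.Tc P ≤ F.z 1 ∧ F.z 1 < σ.Tc P + P.w ∧ GoodTip P.M P.R₀ F.z}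

end ESlot

/-! ### The slots cover the guarded tiny-fenced two-arm event -/

/-- The windows cover the tip rows: every `t ∈ [-2M, 0)` lies in the window of index
`⌊(t + 2M) / w⌋ < Nw` (`1 ≤ w`). [folklore] -/
theorem exists_windowE (P : EParams) (hw : 1 ≤ P.w) {t : ℤ} (ht : -(2 * (P.M : ℤ)) ≤ t) (ht0 : t < 0) :
    ∃ ν, ν < P.Nw ∧ P.T₀ ν ≤ t ∧ t < P.T₀ ν + P.w := by
  have h0 : (((t + 2 * P.M).toNat : ℕ) : ℤ) = t + 2 * P.M := by omega
  have h1 : (((t + 2 * P.M).toNat / P.w : ℕ) : ℤ) * P.w ≤ (t + 2 * P.M).toNat := by exact_mod_cast Nat.div_mul_le_self _ _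
  have h2 : (((t + 2 * P.M).toNat : ℕ) : ℤ) < (((t + 2 * P.M).toNat / P.w : ℕ) : ℤ) * P.w + P.w := by
    exact_mod_cast Nat.lt_div_mul_add hw
  refine ⟨(t + 2 * P.M).toNat / P.w, ?_, ?_, ?_⟩
  · unfold EParams.Nw
    have : (t + 2 * P.M).toNat ≤ 2 * P.M := by omega
    exact Nat.lt_succ_of_le (Nat.div_le_div_right this)
  · unfold EParams.T₀; omega
  · unfold EParams.T₀; omega

/-- **The slots cover the guarded tiny-fenced two-arm event**:
`OutTinyExtG ⊆ ⋃_σ (blackArm σ ∩ whiteArm σ)` over the slots with `io, ic < 6`, `jo, jc < K`,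
`no, nc < Nw` (`1 ≤ w`, `1 ≤ R₀`). [cite: Nolin2008, §4.4 (arXiv 0711.4948: Thm. 10, external extremities)] -/
theorem outTinyExtG_subset_iUnion_eslot (P : EParams) (hw : 1 ≤ P.w) (hR : 1 ≤ P.R₀) :
    OutTinyExtG P.M P.n P.k₀ P.K P.R₀ ⊆ ⋃ σ ∈ {σ : ESlot | σ.io < 6 ∧ σ.jo < P.K ∧ σ.no < P.Nw ∧ σ.ic < 6 ∧ σ.jc < P.K ∧ σ.nc < P.Nw},
      ESlot.blackArm P σ ∩ ESlot.whiteArm P σ := by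
  intro ω hω
  obtain ⟨io, hio, ic, hic, Fo, Fc, hgo, hgc⟩ := hω
  have hto : -(2 * (P.M : ℤ)) ≤ Fo.z 1 ∧ Fo.z 1 < 0 := by have h : GoodTip P.M P.R₀ Fo.z := hgo; unfold GoodTip at h; omega
  have htc : -(2 * (P.M : ℤ)) ≤ Fc.z 1 ∧ Fc.z 1 < 0 := by have h : GoodTip P.M P.R₀ Fc.z := hgc; unfold GoodTip at h; omega
  obtain ⟨no, hno, hno1, hno2⟩ := exists_windowE P hw hto.1 hto.2
  obtain ⟨nc, hnc, hnc1, hnc2⟩ := exists_windowE P hw htc.1 htc.2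
  simp only [Set.mem_iUnion, Set.mem_setOf_eq, exists_prop]
  refine ⟨⟨io, Fo.j, no, ic, Fc.j, nc⟩, ⟨hio, Fo.j_lt, hno, hic, Fc.j_lt, hnc⟩, ?_, ?_⟩
  · exact ⟨Fo, rfl, hno1, hno2, hgo⟩
  · exact ⟨Fc, rfl, hnc1, hnc2, hgc⟩

end Literature.Probability.Percolation
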